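import Mathlib.Analysis.Calculus.MeanValue
import Mathlib.Analysis.InnerProductSpace.PiL2
import Literature.Geometry.Lorentzian.Basic

/-!
# Route EIHFluxBalance — `ModulatedKerrHandoff`, stub `stub_annulusRigidity`: paths in the annulus

Helper file for the crux `stmt-FinalStateConjecture-10167`
(`Summit.FinalStateConjecture.FinalStateConjecture.Theses.EIHFluxBalance.ModulatedKerrHandoff`),
line `overlap-modulation-second-iterate`, stub `stub_annulusRigidity` (rigidity of almost-isometric
`C²` maps of a Minkowski annulus).

**Claim (`norm_sub_le_of_norm_fderiv_le`).** On the Euclidean annulus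
`A_R = {x : E4 | R < ‖x‖ < 4R}` (`R > 0`), a map `f` into a real normed space that is differentiable
on `A_R` with `‖Df‖ ≤ M` there has oscillation `‖f x − f y‖ ≤ 40 R M` (`x, y ∈ A_R`).

**Proof.** Any two points are joined inside `A_R` by five straight segments, each of length `≤ 8R`:
radially from `x` to `p = (2R/‖x‖) x` on the middle sphere `‖·‖ = 2R` (`radial_segment_subset`);
then along chords of that sphere between points at non-obtuse angle, which stay at norm in
`[√2 R, 2R]` (`chord_segment_subset`): `p → ±2R e₀ → ±2R e₁ → q = (2R/‖y‖) y`, the signs chosen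
so that the angles are non-obtuse (`inner_axisPoint_nonneg`); then radially to `y`. The mean value
inequality on each segment (`Convex.norm_image_sub_le_of_norm_fderiv_le`) concludes. Folklore
(path-connectedness of annuli in dimension `≥ 2`, with constants). [folklore]
-/

noncomputable section

-- `Summit.<S>.<S>.…` (single-problem summit, D-0017) trips core's duplicate-namespace linter.
set_option linter.dupNamespace false

open scoped InnerProductSpace
open Set Literature.Geometry.Lorentzian

namespace Summit.FinalStateConjecture.FinalStateConjecture.Theorems

namespace AnnulusRigidity

variable {F : Type*} [NormedAddCommGroup F] [NormedSpace ℝ F]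

/-! ### Segments inside the annulus -/

/-- **Mean value inequality on a segment of the annulus**: if `segment a b ⊆ A_R`, `f` is
differentiable with `‖Df‖ ≤ M` on `A_R`, then `‖f a − f b‖ ≤ 8 R M` (the segment has length
`≤ ‖a‖ + ‖b‖ ≤ 8R`). [folklore] -/
theorem norm_sub_le_of_segment_subset {R M : ℝ} {f : E4 → F}
    (hf : ∀ z : E4, R < ‖z‖ ∧ ‖z‖ < 4 * R → DifferentiableAt ℝ f z)
    (hM : ∀ z : E4, R < ‖z‖ ∧ ‖z‖ < 4 * R → ‖fderiv ℝ f z‖ ≤ M) {a b : E4}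
    (hab : segment ℝ a b ⊆ {z : E4 | R < ‖z‖ ∧ ‖z‖ < 4 * R}) : ‖f a - f b‖ ≤ 8 * R * M := by
  have ha : R < ‖a‖ ∧ ‖a‖ < 4 * R := hab (left_mem_segment ℝ a b)
  have hb : R < ‖b‖ ∧ ‖b‖ < 4 * R := hab (right_mem_segment ℝ a b)
  have hM0 : 0 ≤ M := (norm_nonneg _).trans (hM a ha)
  have h := (convex_segment a b).norm_image_sub_le_of_norm_fderiv_le (fun z hz ↦ hf z (hab hz))
    (fun z hz ↦ hM z (hab hz)) (right_mem_segment ℝ a b) (left_mem_segment ℝ a b)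
  have hlen : ‖a - b‖ ≤ 8 * R := (norm_sub_le a b).trans (by linarith)
  calc ‖f a - f b‖ ≤ M * ‖a - b‖ := h
    _ ≤ M * (8 * R) := mul_le_mul_of_nonneg_left hlen hM0
    _ = 8 * R * M := by ring

/-- **Radial segments stay in the annulus**: for `x ∈ A_R` the segment from `x` to its radial
projection `(2R/‖x‖) x` on the middle sphere lies in `A_R`. [folklore] -/
theorem radial_segment_subset {R : ℝ} (hR : 0 < R) {x : E4} (hx : R < ‖x‖ ∧ ‖x‖ < 4 * R) :
    segment ℝ x ((2 * R / ‖x‖) • x) ⊆ {z : E4 | R < ‖z‖ ∧ ‖z‖ < 4 * R} := by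
  rintro z ⟨a, b, ha, hb, hab, rfl⟩
  have hx0 : 0 < ‖x‖ := hR.trans hx.1
  have hcoef : 0 ≤ a + b * (2 * R / ‖x‖) := by positivity
  have hnorm : ‖a • x + b • ((2 * R / ‖x‖) • x)‖ = a * ‖x‖ + b * (2 * R) := by
    rw [smul_smul, ← add_smul, norm_smul, Real.norm_of_nonneg hcoef, add_mul, mul_assoc,
      div_mul_cancel₀ _ hx0.ne']
  simp only [mem_setOf_eq, hnorm]
  constructor
  · nlinarith [mul_nonneg ha (sub_nonneg.2 hx.1.le)]
  · nlinarith [mul_nonneg ha (sub_nonneg.2 hx.2.le)]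

/-- **Chords of the middle sphere at non-obtuse angle stay in the annulus**: if
`‖p‖ = ‖q‖ = 2R` and `⟪p, q⟫ ≥ 0` then `segment p q ⊆ A_R` (norms along the chord lie in
`[√2 R, 2R]`). [folklore] -/
theorem chord_segment_subset {R : ℝ} (hR : 0 < R) {p q : E4} (hp : ‖p‖ = 2 * R)
    (hq : ‖q‖ = 2 * R) (hpq : 0 ≤ ⟪p, q⟫_ℝ) :
    segment ℝ p q ⊆ {z : E4 | R < ‖z‖ ∧ ‖z‖ < 4 * R} := by
  rintro z ⟨a, b, ha, hb, hab, rfl⟩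
  refine ⟨?_, ?_⟩
  · have hsq : ‖a • p + b • q‖ ^ 2 = a ^ 2 * (2 * R) ^ 2 + 2 * (a * b * ⟪p, q⟫_ℝ) +
        b ^ 2 * (2 * R) ^ 2 := by
      rw [norm_add_sq_real, norm_smul, norm_smul, real_inner_smul_left, real_inner_smul_right,
        Real.norm_of_nonneg ha, Real.norm_of_nonneg hb, hp, hq]
      ring
    refine lt_of_pow_lt_pow_left₀ 2 (norm_nonneg _) ?_
    rw [hsq]
    have hb' : b = 1 - a := by linarith
    subst hb'
    nlinarith [mul_nonneg (mul_nonneg ha hb) hpq, mul_nonneg (sq_nonneg (a - 1 / 2)) (sq_nonneg R),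
      pow_pos hR 2]
  · calc ‖a • p + b • q‖ ≤ ‖a • p‖ + ‖b • q‖ := norm_add_le _ _
      _ = (a + b) * (2 * R) := by
          rw [norm_smul, norm_smul, Real.norm_of_nonneg ha, Real.norm_of_nonneg hb, hp, hq]; ring
      _ < 4 * R := by rw [hab]; linarith

/-! ### Axis points of the middle sphere -/

/-- The axis point `±2R e_μ` on the side of `u`: norm `2R`. [folklore] -/
theorem norm_axisPoint {R : ℝ} (hR : 0 < R) (u : E4) (μ : Fin 4) :
    ‖EuclideanSpace.single μ (if 0 ≤ u μ then 2 * R else -(2 * R))‖ = 2 * R := by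
  rw [PiLp.norm_single, Real.norm_eq_abs]
  split_ifs <;> simp [abs_of_pos (by linarith : (0 : ℝ) < 2 * R)]

/-- The axis point `±2R e_μ` on the side of `u` makes a non-obtuse angle with `u`. [folklore] -/
theorem inner_axisPoint_nonneg (R : ℝ) (hR : 0 < R) (u : E4) (μ : Fin 4) :
    0 ≤ ⟪u, EuclideanSpace.single μ (if 0 ≤ u μ then 2 * R else -(2 * R))⟫_ℝ := by
  rw [EuclideanSpace.inner_single_right]
  simp only [conj_trivial]
  split_ifs with h
  · exact mul_nonneg (by linarith) h
  · nlinarith [le_of_lt (not_le.1 h)]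

/-- Distinct axis points are orthogonal. [folklore] -/
theorem inner_axisPoint_axisPoint (s t : ℝ) :
    ⟪(EuclideanSpace.single 0 s : E4), EuclideanSpace.single 1 t⟫_ℝ = 0 := by
  rw [EuclideanSpace.inner_single_left]
  simp

/-! ### Oscillation on the annulus -/

/-- **Oscillation bound on the annulus.** If `f` is differentiable on
`A_R = {R < ‖·‖ < 4R} ⊆ E4` (`R > 0`) with `‖Df‖ ≤ M` there, then `‖f x − f y‖ ≤ 40 R M` for all
`x, y ∈ A_R` (five segments of length `≤ 8R` inside `A_R` join `x` to `y`). [folklore] -/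
theorem norm_sub_le_of_norm_fderiv_le {R M : ℝ} (hR : 0 < R) {f : E4 → F}
    (hf : ∀ z : E4, R < ‖z‖ ∧ ‖z‖ < 4 * R → DifferentiableAt ℝ f z)
    (hM : ∀ z : E4, R < ‖z‖ ∧ ‖z‖ < 4 * R → ‖fderiv ℝ f z‖ ≤ M) {x y : E4}
    (hx : R < ‖x‖ ∧ ‖x‖ < 4 * R) (hy : R < ‖y‖ ∧ ‖y‖ < 4 * R) :
    ‖f x - f y‖ ≤ 40 * R * M := by
  -- the way-points
  set p : E4 := (2 * R / ‖x‖) • x with hp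
  set q : E4 := (2 * R / ‖y‖) • y with hq
  set m₀ : E4 := EuclideanSpace.single 0 (if 0 ≤ p 0 then 2 * R else -(2 * R)) with hm₀
  set m₁ : E4 := EuclideanSpace.single 1 (if 0 ≤ q 1 then 2 * R else -(2 * R)) with hm₁
  have hx0 : 0 < ‖x‖ := hR.trans hx.1
  have hy0 : 0 < ‖y‖ := hR.trans hy.1
  have hpn : ‖p‖ = 2 * R := by
    rw [hp, norm_smul, Real.norm_of_nonneg (by positivity), div_mul_cancel₀ _ hx0.ne']
  have hqn : ‖q‖ = 2 * R := by
    rw [hq, norm_smul, Real.norm_of_nonneg (by positivity), div_mul_cancel₀ _ hy0.ne']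
  have hm₀n : ‖m₀‖ = 2 * R := norm_axisPoint hR p 0
  have hm₁n : ‖m₁‖ = 2 * R := norm_axisPoint hR q 1
  -- the five segments
  have h1 : ‖f x - f p‖ ≤ 8 * R * M :=
    norm_sub_le_of_segment_subset hf hM (radial_segment_subset hR hx)
  have h2 : ‖f p - f m₀‖ ≤ 8 * R * M :=
    norm_sub_le_of_segment_subset hf hM
      (chord_segment_subset hR hpn hm₀n (inner_axisPoint_nonneg R hR p 0))
  have h3 : ‖f m₀ - f m₁‖ ≤ 8 * R * M :=
    norm_sub_le_of_segment_subset hf hM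
      (chord_segment_subset hR hm₀n hm₁n (le_of_eq (inner_axisPoint_axisPoint _ _).symm))
  have h4 : ‖f m₁ - f q‖ ≤ 8 * R * M := by
    refine norm_sub_le_of_segment_subset hf hM (chord_segment_subset hR hm₁n hqn ?_)
    rw [real_inner_comm]
    exact inner_axisPoint_nonneg R hR q 1
  have h5 : ‖f q - f y‖ ≤ 8 * R * M := by
    rw [← norm_neg, neg_sub]
    exact norm_sub_le_of_segment_subset hf hM (radial_segment_subset hR hy)
  calc ‖f x - f y‖ ≤ ‖f x - f p‖ + ‖f p - f y‖ := norm_sub_le_norm_sub_add_norm_sub _ _ _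
    _ ≤ ‖f x - f p‖ + (‖f p - f m₀‖ + ‖f m₀ - f y‖) := by
        gcongr; exact norm_sub_le_norm_sub_add_norm_sub _ _ _
    _ ≤ ‖f x - f p‖ + (‖f p - f m₀‖ + (‖f m₀ - f m₁‖ + ‖f m₁ - f y‖)) := by
        gcongr; exact norm_sub_le_norm_sub_add_norm_sub _ _ _
    _ ≤ ‖f x - f p‖ + (‖f p - f m₀‖ + (‖f m₀ - f m₁‖ + (‖f m₁ - f q‖ + ‖f q - f y‖))) := by
        gcongr; exact norm_sub_le_norm_sub_add_norm_sub _ _ _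
    _ ≤ 8 * R * M + (8 * R * M + (8 * R * M + (8 * R * M + 8 * R * M))) := by
        gcongr
    _ = 40 * R * M := by ring

end AnnulusRigidity

/-- Registered sub-goal form (stub `annulusRigidity_norm_sub_le_of_norm_fderiv_le` of the crux item, helper for `stub_annulusRigidity`) of
`AnnulusRigidity.norm_sub_le_of_norm_fderiv_le`: the oscillation bound `‖f x − f y‖ ≤ 40 R M` on the annulus `A_R`. [folklore] -/
theorem annulusRigidity_norm_sub_le_of_norm_fderiv_le : open Literature.Geometry.Lorentzian in ∀ {F : Type*} [NormedAddCommGroup F] [NormedSpace ℝ F] {R M : ℝ}, 0 < R → ∀ {f : E4 → F}, (∀ z : E4, R < ‖z‖ ∧ ‖z‖ < 4 * R → DifferentiableAt ℝ f z) → (∀ z : E4, R < ‖z‖ ∧ ‖z‖ < 4 * R → ‖fderiv ℝ f z‖ ≤ M) → ∀ {x y : E4}, R < ‖x‖ ∧ ‖x‖ < 4 * R → R < ‖y‖ ∧ ‖y‖ < 4 * R → ‖f x - f y‖ ≤ 40 * R * M := by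
  intro F _ _ R M hR f hf hM x y hx hy
  exact AnnulusRigidity.norm_sub_le_of_norm_fderiv_le hR hf hM hx hy

end Summit.FinalStateConjecture.FinalStateConjecture.Theorems

end
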